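import Literature.MathematicalPhysics.QuantumFieldTheory.Balaban1983to89.B16Ineq17NearFlatWilsonLettersLocal
import Literature.MathematicalPhysics.QuantumFieldTheory.Balaban1983to89.Node00.WilsonActionSecondVariationPlaqSmallLattice

/-!
# `Balaban1983to89.B16Ineq17NearFlatWilsonLettersWindow` — [Balaban1989LargeFieldII] (1.7) pp. 357–358 at a near-flat background, one-sided: THE WINDOW EDITION of this seat's Wilson-letter
# skeleton (`B16Ineq17NearFlatWilsonLetters` p599997 ∕ `…Local` p617805·p623648) — bond-wise near-flatness asked ONLY on a finite window `W` of plaquettes (where the flat `∂*∂`-form and the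
# Federbush-type lower bound live), PLAQUETTE smallness `‖↑U₀(∂p) − 1‖ ≤ ε` on the other plaquettes meeting the support of the variation (dag-n12-c's «C1_window + P1», LOCATED-GEOM v3 (W2))

Honest framing: statement-level skeleton of published theorems with citation tags; proofs where landed; nothing here is a claim about the Yang–Mills mass gap.  Cell `pub-ymgap`, HUMAN RULING
D-0062 ∕ D-0149, width seat `pub-ymgap-dag-n12-w4` generation 5 (key K1⁹ `stmt-QuantumFields-27364`, helper, count-neutral; INBOX CLAIM-2).  The lane owner's LOCATED-GEOM v3 memo
(`HOME/pub-ymgap-dag-n12-c/N12-GEOM-V3-MEMO.md` §2): «(W1) Wilson side, WINDOW part (the (1.67)∕(1.7) comparison with the flat curl form on the window box around Λ^(k)): needs σ•U₀ bondwise near 1 on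
the window's plaquette bonds … KEEP, localised.  (W2) Wilson side, FAR part …: only a ONE-SIDED bound is needed … PLAQUETTE smallness … ⇒ C1 can shrink to C1_window … (C1′) Hence the proposed letter:
C1_window (bondwise, on the window box, always inhabitable) + P1: `PlaqSmallOn (Ω₁(Z)-touching plaquettes) ε U₀` (gauge-invariant, from h15T)».  This file is that letter's Wilson-side skeleton:
p617805's `hessian_wilsonAction4_criticalExpChartFamily_ge_flatMin_sub_local` VERBATIM except that (i) the flat bilinear form against which `hm` is read is the WINDOW form
`B_W(u,v) = (1∕N)·Σ_{p∈W} ⟪σ⁰_p u, σ⁰_p v⟫` (`σ⁰_p u = u_{b₁} + u_{b₂} − u_{b₃} − u_{b₄}`, Hilbert–Schmidt inner product (17) of `𝔰𝔲(N)`) instead of the full flat Hessian, (ii) bond-wise `δ`-near-flatness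
is asked on the plaquettes of `W` only, and (iii) plaquette smallness `ε` on the plaquettes meeting `B₀` off `W`; the error constant becomes `32(d−1)δ + 8(d−1)ε + μ + 16(d−1)ρδ₂(2+ρδ₂)`.
CONSUMED BY NAME: this seat's `Node00.WilsonActionSecondVariationPlaqSmallLattice.flatOn_sub_le_deriv_deriv_wilsonAction4_expChart` (the window split), dag-n12-w2's
`Node00.…NearFlat.deriv_deriv_wilsonAction4_expChart_one_eq_norm_sq` ∕ `…L2Letters.abs_deriv_deriv_wilsonAction4_expChart_le_l2` ∕ `sum_plaq_boundary_sq_le`, dag-n12-w3's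
`B11Eq177CriticalFamilyDerivative.deriv_deriv_wilsonAction4_expChart_smul_eq` ∕ `hasFDerivAt_fderiv_wilsonAction4_expChart` ∕ `contDiff_wilsonAction4_expChart`, and this seat's abstract skeleton
`B16Ineq17NearFlatOneSidedSeminorm.hessian_value_criticalFamily_ge_flatMin_sub_seminorm` ∕ `abs_bilin_le_of_symm_of_diag_seminorm` (p598593).

PRINT.  [Balaban1989LargeFieldII] p. 357 foot – p. 358 (1.7): «The leading term in the expansion is the quadratic form with the background field identically equal to 1 … Using the bound (1.67) [10]
for this form, we obtain ⟨H_{1,k}B′, Δ₁(ζ₀)H_{1,k}B′⟩ ≧ γ₀ Σ_{c⊂B^k(Λ₀)}|(∂Q_kH_{1,k}B′)(c)|² − O(1)M²(L^kR_kε_k)² Σ_{b∈Λ₀}|B′(b)|²» — the lower bound is read on the WINDOW `B^k(Λ₀)`; p. 357 «U₀ = exp iξA₀ with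
A₀ small on the domain Z».  [Balaban1985BackgroundPropagators] (3.8) p. 391 «|U(∂p) − 1| < ε», (3.10) p. 392.  [Federbush1986PhaseCellI] p. 321 (0.12) «averaging decreases the action» (this seat's
localized weighted edition `B16Ineq17LocalFederbush.sum_normSq_plaq_QvOp_le_weighted`, p584067, is read on a finite plaquette set — the supplier of `hm` against `B_W`).

CONTENTS (theorems only — no `def`, no `instance`, no `sorry`; the window form is an inline continuous bilinear map).
* §1 the window form: `flatFormOn_apply` (`B_W u v = (1∕N)Σ_{p∈W}⟪σ⁰_p u, σ⁰_p v⟫`), `flatFormOn_apply_self` (`= (1∕N)Σ_{p∈W}‖σ⁰_p u‖²`), `flatFormOn_symm`, `flatFormOn_self_nonneg`,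
  `flatFormOn_self_le_flatSecondVariation` (`B_W(w,w) ≤ D²(A∘expChart 1)(0)(w,w)`, the dropped plaquettes are squares), ★ `abs_flatFormOn_le` (letter (β)_W: `|B_W u v| ≤ 16(d−1)·p u·p v`).
* §2 ★ `letter_delta1_wilson_window` (letter (δ₁)_W: `B_W(w,w) − (32(d−1)δ + 8(d−1)ε)·p(w)² ≤ D²(A∘expChart U₀)(0)(w,w)` for `w` supported in `B₀`, bond-wise `δ` on `W`, plaquette `ε` on the
  plaquettes meeting `B₀` off `W`).
* §3 ★★★ `hessian_wilsonAction4_criticalExpChartFamily_ge_flatMin_sub_window` — THE SKELETON, WINDOW EDITION.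

HONEST SCOPE: elementary calculus∕bookkeeping over landed theorems; nothing of Bałaban's asserted; the junction with the (χ)∕(σ) chain (C1 ↦ C1_window + P1 at the record, `W :=` the window box's
plaquettes, `hm` from the localized Federbush letter) is the lane owner's ∕ knit's; N12 NOT discharged; K1⁹ NOT closed; counts unmoved (5∕27 · 28∕28); one finite 𝕋⁴ programme at fixed ε —
R4 closes the conditional rung `BalabanLadder.UV` only; NOT continuum ∕ ℝ⁴ ∕ OS ∕ mass gap ∕ Clay.
-/

noncomputable section

open Filter Topology Set
open scoped Topology BigOperators InnerProductSpace

namespace Literature.MathematicalPhysics.QuantumFieldTheory.Balaban1983to89.B16Ineq17NearFlatWilsonLettersWindow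

open T4Continuum B15DeterminingSets
open T4AdjointCovarianceUnitary (lieSU)
open Node00
open scoped Matrix.Norms.L2Operator
open B11Eq177CriticalFamilyDerivative (contDiff_wilsonAction4_expChart hasFDerivAt_fderiv_wilsonAction4_expChart deriv_deriv_wilsonAction4_expChart_smul_eq)
open B16Ineq17NearFlatOneSidedSeminorm (abs_bilin_le_of_symm_of_diag_seminorm hessian_value_criticalFamily_ge_flatMin_sub_seminorm)

variable {P : Params} {j : ℕ} {N : ℕ} [NeZero N]

/-! ## §1  The window flat form `B_W(u,v) = (1∕N)·Σ_{p∈W} ⟪σ⁰_p u, σ⁰_p v⟫` -/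

omit [NeZero N] in
/-- **THE WINDOW FORM, EVALUATED**: `B_W u v = (1∕N)·Σ_{p∈W} ⟪u_{b₁}+u_{b₂}−u_{b₃}−u_{b₄}, v_{b₁}+v_{b₂}−v_{b₃}−v_{b₄}⟫` (Hilbert–Schmidt inner product (17) of `𝔰𝔲(N)`).
[cite: Balaban1989LargeFieldII, (1.7) p.358 (the window `B^k(Λ₀)`); Balaban1985Averaging, (17) p.21] -/
theorem flatFormOn_apply (W : Finset (Plaq P j)) (u v : PBond P j → lieSU (Fin N)) :
    ((Fintype.card (Fin N) : ℝ)⁻¹ • ∑ p ∈ W, (innerSL ℝ (E := lieSU (Fin N))).bilinearComp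
        (ContinuousLinearMap.proj (R := ℝ) (φ := fun _ : PBond P j => lieSU (Fin N)) (⟨p.src, p.μ⟩ : PBond P j) + ContinuousLinearMap.proj (R := ℝ) (φ := fun _ : PBond P j => lieSU (Fin N)) (⟨p.src.shift p.μ, p.ν⟩ : PBond P j)
          - ContinuousLinearMap.proj (R := ℝ) (φ := fun _ : PBond P j => lieSU (Fin N)) (⟨p.src.shift p.ν, p.μ⟩ : PBond P j) - ContinuousLinearMap.proj (R := ℝ) (φ := fun _ : PBond P j => lieSU (Fin N)) (⟨p.src, p.ν⟩ : PBond P j))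
        (ContinuousLinearMap.proj (R := ℝ) (φ := fun _ : PBond P j => lieSU (Fin N)) (⟨p.src, p.μ⟩ : PBond P j) + ContinuousLinearMap.proj (R := ℝ) (φ := fun _ : PBond P j => lieSU (Fin N)) (⟨p.src.shift p.μ, p.ν⟩ : PBond P j)
          - ContinuousLinearMap.proj (R := ℝ) (φ := fun _ : PBond P j => lieSU (Fin N)) (⟨p.src.shift p.ν, p.μ⟩ : PBond P j) - ContinuousLinearMap.proj (R := ℝ) (φ := fun _ : PBond P j => lieSU (Fin N)) (⟨p.src, p.ν⟩ : PBond P j))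
        : (PBond P j → lieSU (Fin N)) →L[ℝ] (PBond P j → lieSU (Fin N)) →L[ℝ] ℝ) u v
      = (Fintype.card (Fin N) : ℝ)⁻¹ * ∑ p ∈ W, ⟪u ⟨p.src, p.μ⟩ + u ⟨p.src.shift p.μ, p.ν⟩ - u ⟨p.src.shift p.ν, p.μ⟩ - u ⟨p.src, p.ν⟩,
          v ⟨p.src, p.μ⟩ + v ⟨p.src.shift p.μ, p.ν⟩ - v ⟨p.src.shift p.ν, p.μ⟩ - v ⟨p.src, p.ν⟩⟫_ℝ := by
  simp only [smul_apply, sum_apply, ContinuousLinearMap.bilinearComp_apply, innerSL_apply_apply, smul_eq_mul]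
  rfl

omit [NeZero N] in
/-- **ON THE DIAGONAL**: `B_W w w = (1∕N)·Σ_{p∈W} ‖w_{b₁}+w_{b₂}−w_{b₃}−w_{b₄}‖²` — the flat `∂*∂`-form restricted to the window (dag-n12-w2's `deriv_deriv_wilsonAction4_expChart_one_eq_norm_sq` is `W = univ`).
[cite: Balaban1989LargeFieldII, (1.7) p.358, p.357; Balaban1985BackgroundPropagators, (3.10) p.392] -/
theorem flatFormOn_apply_self (W : Finset (Plaq P j)) (w : PBond P j → lieSU (Fin N)) :
    ((Fintype.card (Fin N) : ℝ)⁻¹ • ∑ p ∈ W, (innerSL ℝ (E := lieSU (Fin N))).bilinearComp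
        (ContinuousLinearMap.proj (R := ℝ) (φ := fun _ : PBond P j => lieSU (Fin N)) (⟨p.src, p.μ⟩ : PBond P j) + ContinuousLinearMap.proj (R := ℝ) (φ := fun _ : PBond P j => lieSU (Fin N)) (⟨p.src.shift p.μ, p.ν⟩ : PBond P j)
          - ContinuousLinearMap.proj (R := ℝ) (φ := fun _ : PBond P j => lieSU (Fin N)) (⟨p.src.shift p.ν, p.μ⟩ : PBond P j) - ContinuousLinearMap.proj (R := ℝ) (φ := fun _ : PBond P j => lieSU (Fin N)) (⟨p.src, p.ν⟩ : PBond P j))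
        (ContinuousLinearMap.proj (R := ℝ) (φ := fun _ : PBond P j => lieSU (Fin N)) (⟨p.src, p.μ⟩ : PBond P j) + ContinuousLinearMap.proj (R := ℝ) (φ := fun _ : PBond P j => lieSU (Fin N)) (⟨p.src.shift p.μ, p.ν⟩ : PBond P j)
          - ContinuousLinearMap.proj (R := ℝ) (φ := fun _ : PBond P j => lieSU (Fin N)) (⟨p.src.shift p.ν, p.μ⟩ : PBond P j) - ContinuousLinearMap.proj (R := ℝ) (φ := fun _ : PBond P j => lieSU (Fin N)) (⟨p.src, p.ν⟩ : PBond P j))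
        : (PBond P j → lieSU (Fin N)) →L[ℝ] (PBond P j → lieSU (Fin N)) →L[ℝ] ℝ) w w
      = (∑ p ∈ W, ‖w ⟨p.src, p.μ⟩ + w ⟨p.src.shift p.μ, p.ν⟩ - w ⟨p.src.shift p.ν, p.μ⟩ - w ⟨p.src, p.ν⟩‖ ^ 2) / (Fintype.card (Fin N) : ℝ) := by
  rw [flatFormOn_apply, inv_mul_eq_div]
  congr 1
  exact Finset.sum_congr rfl fun p _ => real_inner_self_eq_norm_sq _

omit [NeZero N] in
/-- The window form is symmetric. [cite: Balaban1985BackgroundPropagators, (3.10) p.392 (bookkeeping)] -/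
theorem flatFormOn_symm (W : Finset (Plaq P j)) (u v : PBond P j → lieSU (Fin N)) :
    ((Fintype.card (Fin N) : ℝ)⁻¹ • ∑ p ∈ W, (innerSL ℝ (E := lieSU (Fin N))).bilinearComp
        (ContinuousLinearMap.proj (R := ℝ) (φ := fun _ : PBond P j => lieSU (Fin N)) (⟨p.src, p.μ⟩ : PBond P j) + ContinuousLinearMap.proj (R := ℝ) (φ := fun _ : PBond P j => lieSU (Fin N)) (⟨p.src.shift p.μ, p.ν⟩ : PBond P j)
          - ContinuousLinearMap.proj (R := ℝ) (φ := fun _ : PBond P j => lieSU (Fin N)) (⟨p.src.shift p.ν, p.μ⟩ : PBond P j) - ContinuousLinearMap.proj (R := ℝ) (φ := fun _ : PBond P j => lieSU (Fin N)) (⟨p.src, p.ν⟩ : PBond P j))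
        (ContinuousLinearMap.proj (R := ℝ) (φ := fun _ : PBond P j => lieSU (Fin N)) (⟨p.src, p.μ⟩ : PBond P j) + ContinuousLinearMap.proj (R := ℝ) (φ := fun _ : PBond P j => lieSU (Fin N)) (⟨p.src.shift p.μ, p.ν⟩ : PBond P j)
          - ContinuousLinearMap.proj (R := ℝ) (φ := fun _ : PBond P j => lieSU (Fin N)) (⟨p.src.shift p.ν, p.μ⟩ : PBond P j) - ContinuousLinearMap.proj (R := ℝ) (φ := fun _ : PBond P j => lieSU (Fin N)) (⟨p.src, p.ν⟩ : PBond P j))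
        : (PBond P j → lieSU (Fin N)) →L[ℝ] (PBond P j → lieSU (Fin N)) →L[ℝ] ℝ) u v
      = ((Fintype.card (Fin N) : ℝ)⁻¹ • ∑ p ∈ W, (innerSL ℝ (E := lieSU (Fin N))).bilinearComp
        (ContinuousLinearMap.proj (R := ℝ) (φ := fun _ : PBond P j => lieSU (Fin N)) (⟨p.src, p.μ⟩ : PBond P j) + ContinuousLinearMap.proj (R := ℝ) (φ := fun _ : PBond P j => lieSU (Fin N)) (⟨p.src.shift p.μ, p.ν⟩ : PBond P j)
          - ContinuousLinearMap.proj (R := ℝ) (φ := fun _ : PBond P j => lieSU (Fin N)) (⟨p.src.shift p.ν, p.μ⟩ : PBond P j) - ContinuousLinearMap.proj (R := ℝ) (φ := fun _ : PBond P j => lieSU (Fin N)) (⟨p.src, p.ν⟩ : PBond P j))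
        (ContinuousLinearMap.proj (R := ℝ) (φ := fun _ : PBond P j => lieSU (Fin N)) (⟨p.src, p.μ⟩ : PBond P j) + ContinuousLinearMap.proj (R := ℝ) (φ := fun _ : PBond P j => lieSU (Fin N)) (⟨p.src.shift p.μ, p.ν⟩ : PBond P j)
          - ContinuousLinearMap.proj (R := ℝ) (φ := fun _ : PBond P j => lieSU (Fin N)) (⟨p.src.shift p.ν, p.μ⟩ : PBond P j) - ContinuousLinearMap.proj (R := ℝ) (φ := fun _ : PBond P j => lieSU (Fin N)) (⟨p.src, p.ν⟩ : PBond P j))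
        : (PBond P j → lieSU (Fin N)) →L[ℝ] (PBond P j → lieSU (Fin N)) →L[ℝ] ℝ) v u := by
  rw [flatFormOn_apply, flatFormOn_apply]
  congr 1
  exact Finset.sum_congr rfl fun p _ => real_inner_comm _ _

omit [NeZero N] in
/-- The window form is non-negative on the diagonal. [cite: Balaban1989LargeFieldII, (1.7) p.358 (bookkeeping)] -/
theorem flatFormOn_self_nonneg (W : Finset (Plaq P j)) (w : PBond P j → lieSU (Fin N)) :
    0 ≤ ((Fintype.card (Fin N) : ℝ)⁻¹ • ∑ p ∈ W, (innerSL ℝ (E := lieSU (Fin N))).bilinearComp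
        (ContinuousLinearMap.proj (R := ℝ) (φ := fun _ : PBond P j => lieSU (Fin N)) (⟨p.src, p.μ⟩ : PBond P j) + ContinuousLinearMap.proj (R := ℝ) (φ := fun _ : PBond P j => lieSU (Fin N)) (⟨p.src.shift p.μ, p.ν⟩ : PBond P j)
          - ContinuousLinearMap.proj (R := ℝ) (φ := fun _ : PBond P j => lieSU (Fin N)) (⟨p.src.shift p.ν, p.μ⟩ : PBond P j) - ContinuousLinearMap.proj (R := ℝ) (φ := fun _ : PBond P j => lieSU (Fin N)) (⟨p.src, p.ν⟩ : PBond P j))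
        (ContinuousLinearMap.proj (R := ℝ) (φ := fun _ : PBond P j => lieSU (Fin N)) (⟨p.src, p.μ⟩ : PBond P j) + ContinuousLinearMap.proj (R := ℝ) (φ := fun _ : PBond P j => lieSU (Fin N)) (⟨p.src.shift p.μ, p.ν⟩ : PBond P j)
          - ContinuousLinearMap.proj (R := ℝ) (φ := fun _ : PBond P j => lieSU (Fin N)) (⟨p.src.shift p.ν, p.μ⟩ : PBond P j) - ContinuousLinearMap.proj (R := ℝ) (φ := fun _ : PBond P j => lieSU (Fin N)) (⟨p.src, p.ν⟩ : PBond P j))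
        : (PBond P j → lieSU (Fin N)) →L[ℝ] (PBond P j → lieSU (Fin N)) →L[ℝ] ℝ) w w := by
  rw [flatFormOn_apply_self]
  exact div_nonneg (Finset.sum_nonneg fun p _ => sq_nonneg _) (Nat.cast_nonneg _)

/-- **THE WINDOW FORM IS BELOW THE FULL FLAT HESSIAN** (the dropped plaquettes contribute squares): `B_W(w,w) ≤ D²(A∘expChart 1)(0)(w,w)`.
[cite: Balaban1989LargeFieldII, p.357 («the quadratic form with the background field identically equal to 1»); Balaban1985BackgroundPropagators, (3.10) p.392] -/
theorem flatFormOn_self_le_flatSecondVariation (W : Finset (Plaq P j)) (w : PBond P j → lieSU (Fin N)) :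
    ((Fintype.card (Fin N) : ℝ)⁻¹ • ∑ p ∈ W, (innerSL ℝ (E := lieSU (Fin N))).bilinearComp
        (ContinuousLinearMap.proj (R := ℝ) (φ := fun _ : PBond P j => lieSU (Fin N)) (⟨p.src, p.μ⟩ : PBond P j) + ContinuousLinearMap.proj (R := ℝ) (φ := fun _ : PBond P j => lieSU (Fin N)) (⟨p.src.shift p.μ, p.ν⟩ : PBond P j)
          - ContinuousLinearMap.proj (R := ℝ) (φ := fun _ : PBond P j => lieSU (Fin N)) (⟨p.src.shift p.ν, p.μ⟩ : PBond P j) - ContinuousLinearMap.proj (R := ℝ) (φ := fun _ : PBond P j => lieSU (Fin N)) (⟨p.src, p.ν⟩ : PBond P j))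
        (ContinuousLinearMap.proj (R := ℝ) (φ := fun _ : PBond P j => lieSU (Fin N)) (⟨p.src, p.μ⟩ : PBond P j) + ContinuousLinearMap.proj (R := ℝ) (φ := fun _ : PBond P j => lieSU (Fin N)) (⟨p.src.shift p.μ, p.ν⟩ : PBond P j)
          - ContinuousLinearMap.proj (R := ℝ) (φ := fun _ : PBond P j => lieSU (Fin N)) (⟨p.src.shift p.ν, p.μ⟩ : PBond P j) - ContinuousLinearMap.proj (R := ℝ) (φ := fun _ : PBond P j => lieSU (Fin N)) (⟨p.src, p.ν⟩ : PBond P j))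
        : (PBond P j → lieSU (Fin N)) →L[ℝ] (PBond P j → lieSU (Fin N)) →L[ℝ] ℝ) w w
      ≤ fderiv ℝ (fun Y => fderiv ℝ (fun Y : PBond P j → lieSU (Fin N) => wilsonAction4 (expChart (1 : GaugeField P j (SU N)) Y)) Y) 0 w w := by
  rw [flatFormOn_apply_self, ← deriv_deriv_wilsonAction4_expChart_smul_eq 1 w, deriv_deriv_wilsonAction4_expChart_one_eq_norm_sq]
  exact div_le_div_of_nonneg_right (Finset.sum_le_univ_sum_of_nonneg fun p => sq_nonneg _) (Nat.cast_nonneg _)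

/-- ★ **LETTER (β)_W**: for a seminorm `p` dominating the `ℓ²(bonds)` operator-norm sum, `|B_W u v| ≤ 16(d−1)·p u·p v` (diagonal bound `B_W(w,w) ≤ D²(A∘expChart 1)(0)(w,w) ≤ 8(d−1)p(w)²` —
dag-n12-w2's `…_le_l2` — polarised by symmetry). [cite: Balaban1985BackgroundPropagators, (3.10) p.392 («a bounded … operator»); Balaban1989LargeFieldII, (1.7) p.358] -/
theorem abs_flatFormOn_le (W : Finset (Plaq P j)) (p : Seminorm ℝ (PBond P j → lieSU (Fin N)))
    (hp : ∀ X : PBond P j → lieSU (Fin N), ∑ b, ‖(X b : Matrix (Fin N) (Fin N) ℂ)‖ ^ 2 ≤ p X ^ 2) (u v : PBond P j → lieSU (Fin N)) :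
    |((Fintype.card (Fin N) : ℝ)⁻¹ • ∑ p ∈ W, (innerSL ℝ (E := lieSU (Fin N))).bilinearComp
        (ContinuousLinearMap.proj (R := ℝ) (φ := fun _ : PBond P j => lieSU (Fin N)) (⟨p.src, p.μ⟩ : PBond P j) + ContinuousLinearMap.proj (R := ℝ) (φ := fun _ : PBond P j => lieSU (Fin N)) (⟨p.src.shift p.μ, p.ν⟩ : PBond P j)
          - ContinuousLinearMap.proj (R := ℝ) (φ := fun _ : PBond P j => lieSU (Fin N)) (⟨p.src.shift p.ν, p.μ⟩ : PBond P j) - ContinuousLinearMap.proj (R := ℝ) (φ := fun _ : PBond P j => lieSU (Fin N)) (⟨p.src, p.ν⟩ : PBond P j))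
        (ContinuousLinearMap.proj (R := ℝ) (φ := fun _ : PBond P j => lieSU (Fin N)) (⟨p.src, p.μ⟩ : PBond P j) + ContinuousLinearMap.proj (R := ℝ) (φ := fun _ : PBond P j => lieSU (Fin N)) (⟨p.src.shift p.μ, p.ν⟩ : PBond P j)
          - ContinuousLinearMap.proj (R := ℝ) (φ := fun _ : PBond P j => lieSU (Fin N)) (⟨p.src.shift p.ν, p.μ⟩ : PBond P j) - ContinuousLinearMap.proj (R := ℝ) (φ := fun _ : PBond P j => lieSU (Fin N)) (⟨p.src, p.ν⟩ : PBond P j))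
        : (PBond P j → lieSU (Fin N)) →L[ℝ] (PBond P j → lieSU (Fin N)) →L[ℝ] ℝ) u v|
      ≤ 16 * ((P.d : ℝ) - 1) * p u * p v := by
  have hd : 0 ≤ (P.d : ℝ) - 1 := by
    have := P.hd
    have h1 : (1 : ℝ) ≤ P.d := by exact_mod_cast this
    linarith
  have hdiag : ∀ w : PBond P j → lieSU (Fin N), |((Fintype.card (Fin N) : ℝ)⁻¹ • ∑ p ∈ W, (innerSL ℝ (E := lieSU (Fin N))).bilinearComp
          (ContinuousLinearMap.proj (R := ℝ) (φ := fun _ : PBond P j => lieSU (Fin N)) (⟨p.src, p.μ⟩ : PBond P j) + ContinuousLinearMap.proj (R := ℝ) (φ := fun _ : PBond P j => lieSU (Fin N)) (⟨p.src.shift p.μ, p.ν⟩ : PBond P j)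
            - ContinuousLinearMap.proj (R := ℝ) (φ := fun _ : PBond P j => lieSU (Fin N)) (⟨p.src.shift p.ν, p.μ⟩ : PBond P j) - ContinuousLinearMap.proj (R := ℝ) (φ := fun _ : PBond P j => lieSU (Fin N)) (⟨p.src, p.ν⟩ : PBond P j))
          (ContinuousLinearMap.proj (R := ℝ) (φ := fun _ : PBond P j => lieSU (Fin N)) (⟨p.src, p.μ⟩ : PBond P j) + ContinuousLinearMap.proj (R := ℝ) (φ := fun _ : PBond P j => lieSU (Fin N)) (⟨p.src.shift p.μ, p.ν⟩ : PBond P j)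
            - ContinuousLinearMap.proj (R := ℝ) (φ := fun _ : PBond P j => lieSU (Fin N)) (⟨p.src.shift p.ν, p.μ⟩ : PBond P j) - ContinuousLinearMap.proj (R := ℝ) (φ := fun _ : PBond P j => lieSU (Fin N)) (⟨p.src, p.ν⟩ : PBond P j))
          : (PBond P j → lieSU (Fin N)) →L[ℝ] (PBond P j → lieSU (Fin N)) →L[ℝ] ℝ) w w|
      ≤ 8 * ((P.d : ℝ) - 1) * p w ^ 2 := by
    intro w
    rw [abs_of_nonneg (flatFormOn_self_nonneg W w)]
    refine (flatFormOn_self_le_flatSecondVariation W w).trans ?_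
    have h := abs_deriv_deriv_wilsonAction4_expChart_le_l2 (1 : GaugeField P j (SU N)) w
    rw [deriv_deriv_wilsonAction4_expChart_smul_eq 1 w] at h
    exact (le_abs_self _).trans (h.trans (mul_le_mul_of_nonneg_left (hp w) (by positivity)))
  have h := abs_bilin_le_of_symm_of_diag_seminorm p
    ((Fintype.card (Fin N) : ℝ)⁻¹ • ∑ p ∈ W, (innerSL ℝ (E := lieSU (Fin N))).bilinearComp
      (ContinuousLinearMap.proj (R := ℝ) (φ := fun _ : PBond P j => lieSU (Fin N)) (⟨p.src, p.μ⟩ : PBond P j) + ContinuousLinearMap.proj (R := ℝ) (φ := fun _ : PBond P j => lieSU (Fin N)) (⟨p.src.shift p.μ, p.ν⟩ : PBond P j)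
        - ContinuousLinearMap.proj (R := ℝ) (φ := fun _ : PBond P j => lieSU (Fin N)) (⟨p.src.shift p.ν, p.μ⟩ : PBond P j) - ContinuousLinearMap.proj (R := ℝ) (φ := fun _ : PBond P j => lieSU (Fin N)) (⟨p.src, p.ν⟩ : PBond P j))
      (ContinuousLinearMap.proj (R := ℝ) (φ := fun _ : PBond P j => lieSU (Fin N)) (⟨p.src, p.μ⟩ : PBond P j) + ContinuousLinearMap.proj (R := ℝ) (φ := fun _ : PBond P j => lieSU (Fin N)) (⟨p.src.shift p.μ, p.ν⟩ : PBond P j)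
        - ContinuousLinearMap.proj (R := ℝ) (φ := fun _ : PBond P j => lieSU (Fin N)) (⟨p.src.shift p.ν, p.μ⟩ : PBond P j) - ContinuousLinearMap.proj (R := ℝ) (φ := fun _ : PBond P j => lieSU (Fin N)) (⟨p.src, p.ν⟩ : PBond P j))
      : (PBond P j → lieSU (Fin N)) →L[ℝ] (PBond P j → lieSU (Fin N)) →L[ℝ] ℝ)
    (flatFormOn_symm W) (β' := 8 * ((P.d : ℝ) - 1)) (by positivity) hdiag u v
  calc _ ≤ 2 * (8 * ((P.d : ℝ) - 1)) * p u * p v := h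
    _ = 16 * ((P.d : ℝ) - 1) * p u * p v := by ring

/-! ## §2  The letter (δ₁)_W: bond-wise `δ` on the window, plaquette `ε` off it -/

omit [NeZero N] in
/-- Off the plaquettes meeting `B₀` the four letters of a field supported in `B₀` vanish. [folklore] [cite: Balaban1989LargeFieldII, p.357 (bookkeeping)] -/
private theorem letters_vanish_off' (X : PBond P j → lieSU (Fin N)) (B₀ : Set (PBond P j)) (hX : ∀ b ∉ B₀, X b = 0) (p : Plaq P j)
    (h : ¬ ((⟨p.src, p.μ⟩ : PBond P j) ∈ B₀ ∨ (⟨p.src.shift p.μ, p.ν⟩ : PBond P j) ∈ B₀ ∨ (⟨p.src.shift p.ν, p.μ⟩ : PBond P j) ∈ B₀ ∨ (⟨p.src, p.ν⟩ : PBond P j) ∈ B₀)) :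
    (‖(X ⟨p.src, p.μ⟩ : Matrix (Fin N) (Fin N) ℂ)‖ + ‖(X ⟨p.src.shift p.μ, p.ν⟩ : Matrix (Fin N) (Fin N) ℂ)‖ + ‖(X ⟨p.src.shift p.ν, p.μ⟩ : Matrix (Fin N) (Fin N) ℂ)‖ + ‖(X ⟨p.src, p.ν⟩ : Matrix (Fin N) (Fin N) ℂ)‖) = 0 := by
  simp only [not_or] at h
  obtain ⟨h1, h2, h3, h4⟩ := h
  rw [hX _ h1, hX _ h2, hX _ h3, hX _ h4]
  simp

/-- ★ **LETTER (δ₁)_W — THE WINDOW FORM AGAINST THE SECOND VARIATION AT `U₀`**: for a seminorm `p` dominating the `ℓ²(bonds)` operator-norm sum, `w` vanishing off `B₀`, bond-wise `‖↑U₀_b − 1‖ ≤ δ` on the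
four bonds of every plaquette of the window `W`, and plaquette smallness `‖↑U₀(∂p) − 1‖ ≤ ε` on every plaquette MEETING `B₀` off `W` (`0 ≤ δ`, `0 ≤ ε`):
`B_W(w,w) − (32(d−1)δ + 8(d−1)ε)·p(w)² ≤ D²(A∘expChart U₀)(0)(w,w)` — this seat's window split with budgets `δ` on `W`, `ε`∕`2` off `W`, and the incidence count `Σ_p s_p² ≤ 8(d−1)Σ_b‖w_b‖²`.
[cite: Balaban1989LargeFieldII, p.357, (1.7) p.358; Balaban1985BackgroundPropagators, (3.8) p.391, (3.10) p.392] -/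
theorem letter_delta1_wilson_window (U₀ : GaugeField P j (SU N)) (W : Finset (Plaq P j)) (B₀ : Set (PBond P j)) {δ ε : ℝ} (hδ0 : 0 ≤ δ) (hε0 : 0 ≤ ε)
    (hU : ∀ p ∈ W, ‖(U₀ ⟨p.src, p.μ⟩ : Matrix (Fin N) (Fin N) ℂ) - 1‖ ≤ δ ∧ ‖(U₀ ⟨p.src.shift p.μ, p.ν⟩ : Matrix (Fin N) (Fin N) ℂ) - 1‖ ≤ δ
        ∧ ‖(U₀ ⟨p.src.shift p.ν, p.μ⟩ : Matrix (Fin N) (Fin N) ℂ) - 1‖ ≤ δ ∧ ‖(U₀ ⟨p.src, p.ν⟩ : Matrix (Fin N) (Fin N) ℂ) - 1‖ ≤ δ)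
    (hP : ∀ p ∉ W, ((⟨p.src, p.μ⟩ : PBond P j) ∈ B₀ ∨ (⟨p.src.shift p.μ, p.ν⟩ : PBond P j) ∈ B₀ ∨ (⟨p.src.shift p.ν, p.μ⟩ : PBond P j) ∈ B₀ ∨ (⟨p.src, p.ν⟩ : PBond P j) ∈ B₀) →
      ‖((GaugeField.plaqHol U₀ p : SU N) : Matrix (Fin N) (Fin N) ℂ) - 1‖ ≤ ε)
    (p : Seminorm ℝ (PBond P j → lieSU (Fin N))) (hp : ∀ X : PBond P j → lieSU (Fin N), ∑ b, ‖(X b : Matrix (Fin N) (Fin N) ℂ)‖ ^ 2 ≤ p X ^ 2)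
    (w : PBond P j → lieSU (Fin N)) (hw : ∀ b ∉ B₀, w b = 0) :
    ((Fintype.card (Fin N) : ℝ)⁻¹ • ∑ p ∈ W, (innerSL ℝ (E := lieSU (Fin N))).bilinearComp
        (ContinuousLinearMap.proj (R := ℝ) (φ := fun _ : PBond P j => lieSU (Fin N)) (⟨p.src, p.μ⟩ : PBond P j) + ContinuousLinearMap.proj (R := ℝ) (φ := fun _ : PBond P j => lieSU (Fin N)) (⟨p.src.shift p.μ, p.ν⟩ : PBond P j)
          - ContinuousLinearMap.proj (R := ℝ) (φ := fun _ : PBond P j => lieSU (Fin N)) (⟨p.src.shift p.ν, p.μ⟩ : PBond P j) - ContinuousLinearMap.proj (R := ℝ) (φ := fun _ : PBond P j => lieSU (Fin N)) (⟨p.src, p.ν⟩ : PBond P j))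
        (ContinuousLinearMap.proj (R := ℝ) (φ := fun _ : PBond P j => lieSU (Fin N)) (⟨p.src, p.μ⟩ : PBond P j) + ContinuousLinearMap.proj (R := ℝ) (φ := fun _ : PBond P j => lieSU (Fin N)) (⟨p.src.shift p.μ, p.ν⟩ : PBond P j)
          - ContinuousLinearMap.proj (R := ℝ) (φ := fun _ : PBond P j => lieSU (Fin N)) (⟨p.src.shift p.ν, p.μ⟩ : PBond P j) - ContinuousLinearMap.proj (R := ℝ) (φ := fun _ : PBond P j => lieSU (Fin N)) (⟨p.src, p.ν⟩ : PBond P j))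
        : (PBond P j → lieSU (Fin N)) →L[ℝ] (PBond P j → lieSU (Fin N)) →L[ℝ] ℝ) w w
        - (32 * ((P.d : ℝ) - 1) * δ + 8 * ((P.d : ℝ) - 1) * ε) * p w ^ 2
      ≤ fderiv ℝ (fun Y => fderiv ℝ (fun Y : PBond P j → lieSU (Fin N) => wilsonAction4 (expChart U₀ Y)) Y) 0 w w := by
  classical
  have hd : 0 ≤ (P.d : ℝ) - 1 := by
    have := P.hd
    have h1 : (1 : ℝ) ≤ P.d := by exact_mod_cast this
    linarith
  -- plaquette budget off the window: `ε` on the plaquettes meeting `B₀`, `2` elsewhere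
  let bud : Plaq P j → ℝ := fun p => if ((⟨p.src, p.μ⟩ : PBond P j) ∈ B₀ ∨ (⟨p.src.shift p.μ, p.ν⟩ : PBond P j) ∈ B₀ ∨ (⟨p.src.shift p.ν, p.μ⟩ : PBond P j) ∈ B₀ ∨ (⟨p.src, p.ν⟩ : PBond P j) ∈ B₀) then ε else 2
  have hbud : ∀ p ∉ W, ‖((GaugeField.plaqHol U₀ p : SU N) : Matrix (Fin N) (Fin N) ℂ) - 1‖ ≤ bud p := by
    intro p hp
    by_cases h : ((⟨p.src, p.μ⟩ : PBond P j) ∈ B₀ ∨ (⟨p.src.shift p.μ, p.ν⟩ : PBond P j) ∈ B₀ ∨ (⟨p.src.shift p.ν, p.μ⟩ : PBond P j) ∈ B₀ ∨ (⟨p.src, p.ν⟩ : PBond P j) ∈ B₀)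
    · have hb : bud p = ε := if_pos h
      rw [hb]; exact hP p hp h
    · have hb : bud p = 2 := if_neg h
      rw [hb]; exact norm_coe_plaqHol_sub_one_le_two U₀ p
  have hmain := flatOn_sub_le_deriv_deriv_wilsonAction4_expChart U₀ w W (fun _ => δ) bud (fun p hp => hU p hp) hbud
  rw [deriv_deriv_wilsonAction4_expChart_smul_eq U₀ w] at hmain
  -- the two error sums against `Σ_b ‖w_b‖²`
  have hS := sum_plaq_boundary_sq_le fun b => ‖(w b : Matrix (Fin N) (Fin N) ℂ)‖
  have hs0 : ∀ p : Plaq P j, 0 ≤ (‖(w ⟨p.src, p.μ⟩ : Matrix (Fin N) (Fin N) ℂ)‖ + ‖(w ⟨p.src.shift p.μ, p.ν⟩ : Matrix (Fin N) (Fin N) ℂ)‖ + ‖(w ⟨p.src.shift p.ν, p.μ⟩ : Matrix (Fin N) (Fin N) ℂ)‖ + ‖(w ⟨p.src, p.ν⟩ : Matrix (Fin N) (Fin N) ℂ)‖) ^ 2 := fun p => sq_nonneg _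
  have hWsum : ∑ p ∈ W, δ * (‖(w ⟨p.src, p.μ⟩ : Matrix (Fin N) (Fin N) ℂ)‖ + ‖(w ⟨p.src.shift p.μ, p.ν⟩ : Matrix (Fin N) (Fin N) ℂ)‖ + ‖(w ⟨p.src.shift p.ν, p.μ⟩ : Matrix (Fin N) (Fin N) ℂ)‖ + ‖(w ⟨p.src, p.ν⟩ : Matrix (Fin N) (Fin N) ℂ)‖) ^ 2
      ≤ δ * (8 * ((P.d : ℝ) - 1) * ∑ b : PBond P j, ‖(w b : Matrix (Fin N) (Fin N) ℂ)‖ ^ 2) := by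
    rw [← Finset.mul_sum]
    exact mul_le_mul_of_nonneg_left ((Finset.sum_le_univ_sum_of_nonneg hs0).trans hS) hδ0
  have hterm : ∀ p : Plaq P j, bud p * (‖(w ⟨p.src, p.μ⟩ : Matrix (Fin N) (Fin N) ℂ)‖ + ‖(w ⟨p.src.shift p.μ, p.ν⟩ : Matrix (Fin N) (Fin N) ℂ)‖ + ‖(w ⟨p.src.shift p.ν, p.μ⟩ : Matrix (Fin N) (Fin N) ℂ)‖ + ‖(w ⟨p.src, p.ν⟩ : Matrix (Fin N) (Fin N) ℂ)‖) ^ 2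
      ≤ ε * (‖(w ⟨p.src, p.μ⟩ : Matrix (Fin N) (Fin N) ℂ)‖ + ‖(w ⟨p.src.shift p.μ, p.ν⟩ : Matrix (Fin N) (Fin N) ℂ)‖ + ‖(w ⟨p.src.shift p.ν, p.μ⟩ : Matrix (Fin N) (Fin N) ℂ)‖ + ‖(w ⟨p.src, p.ν⟩ : Matrix (Fin N) (Fin N) ℂ)‖) ^ 2 := by
    intro p
    by_cases h : ((⟨p.src, p.μ⟩ : PBond P j) ∈ B₀ ∨ (⟨p.src.shift p.μ, p.ν⟩ : PBond P j) ∈ B₀ ∨ (⟨p.src.shift p.ν, p.μ⟩ : PBond P j) ∈ B₀ ∨ (⟨p.src, p.ν⟩ : PBond P j) ∈ B₀)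
    · have hb : bud p = ε := if_pos h
      rw [hb]
    · rw [letters_vanish_off' w B₀ hw p h]
      simp
  have hCsum : ∑ p ∈ Wᶜ, bud p * (‖(w ⟨p.src, p.μ⟩ : Matrix (Fin N) (Fin N) ℂ)‖ + ‖(w ⟨p.src.shift p.μ, p.ν⟩ : Matrix (Fin N) (Fin N) ℂ)‖ + ‖(w ⟨p.src.shift p.ν, p.μ⟩ : Matrix (Fin N) (Fin N) ℂ)‖ + ‖(w ⟨p.src, p.ν⟩ : Matrix (Fin N) (Fin N) ℂ)‖) ^ 2
      ≤ ε * (8 * ((P.d : ℝ) - 1) * ∑ b : PBond P j, ‖(w b : Matrix (Fin N) (Fin N) ℂ)‖ ^ 2) :=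
    calc ∑ p ∈ Wᶜ, bud p * (‖(w ⟨p.src, p.μ⟩ : Matrix (Fin N) (Fin N) ℂ)‖ + ‖(w ⟨p.src.shift p.μ, p.ν⟩ : Matrix (Fin N) (Fin N) ℂ)‖ + ‖(w ⟨p.src.shift p.ν, p.μ⟩ : Matrix (Fin N) (Fin N) ℂ)‖ + ‖(w ⟨p.src, p.ν⟩ : Matrix (Fin N) (Fin N) ℂ)‖) ^ 2
        ≤ ∑ p ∈ Wᶜ, ε * (‖(w ⟨p.src, p.μ⟩ : Matrix (Fin N) (Fin N) ℂ)‖ + ‖(w ⟨p.src.shift p.μ, p.ν⟩ : Matrix (Fin N) (Fin N) ℂ)‖ + ‖(w ⟨p.src.shift p.ν, p.μ⟩ : Matrix (Fin N) (Fin N) ℂ)‖ + ‖(w ⟨p.src, p.ν⟩ : Matrix (Fin N) (Fin N) ℂ)‖) ^ 2 := Finset.sum_le_sum fun p _ => hterm p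
      _ ≤ ∑ p : Plaq P j, ε * (‖(w ⟨p.src, p.μ⟩ : Matrix (Fin N) (Fin N) ℂ)‖ + ‖(w ⟨p.src.shift p.μ, p.ν⟩ : Matrix (Fin N) (Fin N) ℂ)‖ + ‖(w ⟨p.src.shift p.ν, p.μ⟩ : Matrix (Fin N) (Fin N) ℂ)‖ + ‖(w ⟨p.src, p.ν⟩ : Matrix (Fin N) (Fin N) ℂ)‖) ^ 2 :=
          Finset.sum_le_univ_sum_of_nonneg fun p => mul_nonneg hε0 (hs0 p)
      _ = ε * ∑ p : Plaq P j, (‖(w ⟨p.src, p.μ⟩ : Matrix (Fin N) (Fin N) ℂ)‖ + ‖(w ⟨p.src.shift p.μ, p.ν⟩ : Matrix (Fin N) (Fin N) ℂ)‖ + ‖(w ⟨p.src.shift p.ν, p.μ⟩ : Matrix (Fin N) (Fin N) ℂ)‖ + ‖(w ⟨p.src, p.ν⟩ : Matrix (Fin N) (Fin N) ℂ)‖) ^ 2 := by rw [← Finset.mul_sum]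
      _ ≤ ε * (8 * ((P.d : ℝ) - 1) * ∑ b : PBond P j, ‖(w b : Matrix (Fin N) (Fin N) ℂ)‖ ^ 2) := mul_le_mul_of_nonneg_left hS hε0
  have hpw := hp w
  have hB := flatFormOn_apply_self W w
  rw [hB]
  nlinarith [mul_le_mul_of_nonneg_left hpw (show 0 ≤ 32 * ((P.d : ℝ) - 1) * δ + 8 * ((P.d : ℝ) - 1) * ε by positivity)]

/-! ## §3  The near-flat one-sided (1.7) skeleton — WINDOW EDITION -/

/-- ★★★ **THE SKELETON AT THE WILSON ACTION, WINDOW EDITION** — `B16Ineq17NearFlatWilsonLettersLocal.hessian_wilsonAction4_criticalExpChartFamily_ge_flatMin_sub_local` VERBATIM except: the flat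
form against which the fibre bound `hm` is read is the WINDOW form `B_W` of §1 (`W : Finset (Plaq P j)`), bond-wise `δ`-near-flatness `hU` is asked on the plaquettes of `W` only, and plaquette
smallness `hP : ‖↑U₀(∂p) − 1‖ ≤ ε` on the plaquettes meeting `B₀` off `W`; conclusion
`m − (32(d−1)δ + 8(d−1)ε + μ + 16(d−1)ρδ₂(2+ρδ₂))·p(X′h)² ≤ D²(A∘expChart U₀∘X)(g₀)(h,h)` (abstract skeleton `hessian_value_criticalFamily_ge_flatMin_sub_seminorm` with `Bf := B_W`,
`hβ := abs_flatFormOn_le`, `hδ₁ := letter_delta1_wilson_window`). [cite: Balaban1989LargeFieldII, (1.7) pp.357–358, (1.12) p.359; Balaban1985BackgroundPropagators, (3.8) p.391, (3.10) p.392; Balaban1985Variational, (172)–(177) pp.305–306] -/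
theorem hessian_wilsonAction4_criticalExpChartFamily_ge_flatMin_sub_window
    {V G : Type*} [NormedAddCommGroup V] [NormedSpace ℝ V] [NormedAddCommGroup G] [NormedSpace ℝ G]
    (U₀ : GaugeField P j (SU N)) (W : Finset (Plaq P j)) (B₀ : Set (PBond P j)) {δ ε : ℝ} (hδ0 : 0 ≤ δ) (hε0 : 0 ≤ ε)
    (hU : ∀ p ∈ W, ‖(U₀ ⟨p.src, p.μ⟩ : Matrix (Fin N) (Fin N) ℂ) - 1‖ ≤ δ ∧ ‖(U₀ ⟨p.src.shift p.μ, p.ν⟩ : Matrix (Fin N) (Fin N) ℂ) - 1‖ ≤ δ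
        ∧ ‖(U₀ ⟨p.src.shift p.ν, p.μ⟩ : Matrix (Fin N) (Fin N) ℂ) - 1‖ ≤ δ ∧ ‖(U₀ ⟨p.src, p.ν⟩ : Matrix (Fin N) (Fin N) ℂ) - 1‖ ≤ δ)
    (hP : ∀ p ∉ W, ((⟨p.src, p.μ⟩ : PBond P j) ∈ B₀ ∨ (⟨p.src.shift p.μ, p.ν⟩ : PBond P j) ∈ B₀ ∨ (⟨p.src.shift p.ν, p.μ⟩ : PBond P j) ∈ B₀ ∨ (⟨p.src, p.ν⟩ : PBond P j) ∈ B₀) →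
      ‖((GaugeField.plaqHol U₀ p : SU N) : Matrix (Fin N) (Fin N) ℂ) - 1‖ ≤ ε)
    {Ψ : (PBond P j → lieSU (Fin N)) → V} {X : G → PBond P j → lieSU (Fin N)} {g₀ : G}
    (hX₀ : X g₀ = 0) {X' : G →L[ℝ] PBond P j → lieSU (Fin N)} (hX : HasFDerivAt X X' g₀)
    {X₂ : G →L[ℝ] G →L[ℝ] PBond P j → lieSU (Fin N)} (hX₂ : HasFDerivAt (fun g => fderiv ℝ X g) X₂ g₀)
    (hXd : ∀ᶠ g in 𝓝 g₀, DifferentiableAt ℝ X g)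
    {Ψ₂ : (PBond P j → lieSU (Fin N)) →L[ℝ] (PBond P j → lieSU (Fin N)) →L[ℝ] V} (hΨ₂ : HasFDerivAt (fun Y => fderiv ℝ Ψ Y) Ψ₂ 0)
    (hΨd : ∀ᶠ Y in 𝓝 (0 : PBond P j → lieSU (Fin N)), DifferentiableAt ℝ Ψ Y)
    {lam : V →L[ℝ] ℝ} (hlam : fderiv ℝ (fun Y : PBond P j → lieSU (Fin N) => wilsonAction4 (expChart U₀ Y)) 0 = lam.comp (fderiv ℝ Ψ 0)) (h : G)
    (hsupp : ∀ b ∉ B₀, X' h b = 0)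
    (haff : lam (fderiv ℝ (fun g => fderiv ℝ (fun g => Ψ (X g)) g) g₀ h h) = 0)
    (p : Seminorm ℝ (PBond P j → lieSU (Fin N))) (hp : ∀ Y : PBond P j → lieSU (Fin N), ∑ b, ‖(Y b : Matrix (Fin N) (Fin N) ℂ)‖ ^ 2 ≤ p Y ^ 2)
    (q : V → ℝ) (Lf : (PBond P j → lieSU (Fin N)) →L[ℝ] V) {Rf : V → PBond P j → lieSU (Fin N)} {μ ρ δ₂ : ℝ} (hρ0 : 0 ≤ ρ)
    (hRf : ∀ v, Lf (Rf v) = v) (hρ : ∀ v, p (Rf v) ≤ ρ * q v)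
    (hδ₂ : q (fderiv ℝ Ψ 0 (X' h) - Lf (X' h)) ≤ δ₂ * p (X' h))
    (hμ : lam (Ψ₂ (X' h) (X' h)) ≤ μ * p (X' h) ^ 2)
    {m : ℝ} (hm : ∀ w', Lf w' = fderiv ℝ Ψ 0 (X' h) →
      m ≤ ((Fintype.card (Fin N) : ℝ)⁻¹ • ∑ p ∈ W, (innerSL ℝ (E := lieSU (Fin N))).bilinearComp
          (ContinuousLinearMap.proj (R := ℝ) (φ := fun _ : PBond P j => lieSU (Fin N)) (⟨p.src, p.μ⟩ : PBond P j) + ContinuousLinearMap.proj (R := ℝ) (φ := fun _ : PBond P j => lieSU (Fin N)) (⟨p.src.shift p.μ, p.ν⟩ : PBond P j)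
            - ContinuousLinearMap.proj (R := ℝ) (φ := fun _ : PBond P j => lieSU (Fin N)) (⟨p.src.shift p.ν, p.μ⟩ : PBond P j) - ContinuousLinearMap.proj (R := ℝ) (φ := fun _ : PBond P j => lieSU (Fin N)) (⟨p.src, p.ν⟩ : PBond P j))
          (ContinuousLinearMap.proj (R := ℝ) (φ := fun _ : PBond P j => lieSU (Fin N)) (⟨p.src, p.μ⟩ : PBond P j) + ContinuousLinearMap.proj (R := ℝ) (φ := fun _ : PBond P j => lieSU (Fin N)) (⟨p.src.shift p.μ, p.ν⟩ : PBond P j)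
            - ContinuousLinearMap.proj (R := ℝ) (φ := fun _ : PBond P j => lieSU (Fin N)) (⟨p.src.shift p.ν, p.μ⟩ : PBond P j) - ContinuousLinearMap.proj (R := ℝ) (φ := fun _ : PBond P j => lieSU (Fin N)) (⟨p.src, p.ν⟩ : PBond P j))
          : (PBond P j → lieSU (Fin N)) →L[ℝ] (PBond P j → lieSU (Fin N)) →L[ℝ] ℝ) w' w') :
    m - (32 * ((P.d : ℝ) - 1) * δ + 8 * ((P.d : ℝ) - 1) * ε + μ + 16 * ((P.d : ℝ) - 1) * (ρ * δ₂) * (2 + ρ * δ₂)) * p (X' h) ^ 2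
      ≤ fderiv ℝ (fun g => fderiv ℝ (fun g => wilsonAction4 (expChart U₀ (X g))) g) g₀ h h := by
  have hd : 0 ≤ (P.d : ℝ) - 1 := by
    have := P.hd
    have h1 : (1 : ℝ) ≤ P.d := by exact_mod_cast this
    linarith
  exact hessian_value_criticalFamily_ge_flatMin_sub_seminorm hX₀ hX hX₂ hXd (hasFDerivAt_fderiv_wilsonAction4_expChart U₀ 0)
    (Filter.Eventually.of_forall fun Y => ((contDiff_wilsonAction4_expChart U₀).differentiable (by simp)).differentiableAt)
    hΨ₂ hΨd hlam h haff p q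
    ((Fintype.card (Fin N) : ℝ)⁻¹ • ∑ p ∈ W, (innerSL ℝ (E := lieSU (Fin N))).bilinearComp
      (ContinuousLinearMap.proj (R := ℝ) (φ := fun _ : PBond P j => lieSU (Fin N)) (⟨p.src, p.μ⟩ : PBond P j) + ContinuousLinearMap.proj (R := ℝ) (φ := fun _ : PBond P j => lieSU (Fin N)) (⟨p.src.shift p.μ, p.ν⟩ : PBond P j)
        - ContinuousLinearMap.proj (R := ℝ) (φ := fun _ : PBond P j => lieSU (Fin N)) (⟨p.src.shift p.ν, p.μ⟩ : PBond P j) - ContinuousLinearMap.proj (R := ℝ) (φ := fun _ : PBond P j => lieSU (Fin N)) (⟨p.src, p.ν⟩ : PBond P j))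
      (ContinuousLinearMap.proj (R := ℝ) (φ := fun _ : PBond P j => lieSU (Fin N)) (⟨p.src, p.μ⟩ : PBond P j) + ContinuousLinearMap.proj (R := ℝ) (φ := fun _ : PBond P j => lieSU (Fin N)) (⟨p.src.shift p.μ, p.ν⟩ : PBond P j)
        - ContinuousLinearMap.proj (R := ℝ) (φ := fun _ : PBond P j => lieSU (Fin N)) (⟨p.src.shift p.ν, p.μ⟩ : PBond P j) - ContinuousLinearMap.proj (R := ℝ) (φ := fun _ : PBond P j => lieSU (Fin N)) (⟨p.src, p.ν⟩ : PBond P j))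
      : (PBond P j → lieSU (Fin N)) →L[ℝ] (PBond P j → lieSU (Fin N)) →L[ℝ] ℝ)
    Lf (β := 16 * ((P.d : ℝ) - 1)) (by positivity) hρ0 (abs_flatFormOn_le W p hp) hRf hρ hδ₂
    (letter_delta1_wilson_window U₀ W B₀ hδ0 hε0 hU hP p hp (X' h) hsupp) hμ hm

end Literature.MathematicalPhysics.QuantumFieldTheory.Balaban1983to89.B16Ineq17NearFlatWilsonLettersWindow

end
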